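import Mathlib.Topology.Algebra.Module.FiniteDimension
import Literature.NumberTheory.EllipticCurves.NewformGaloisRepDeligneProofs
import Literature.NumberTheory.EllipticCurves.DeligneSerreProp27LevelDescentProofs
import Literature.NumberTheory.EllipticCurves.DeligneSerreProp27Proofs
import Literature.NumberTheory.EllipticCurves.DeligneSerreWeightOneProofs
import Literature.NumberTheory.Automorphic.LanglandsTunnellLSeriesProofs
import Literature.NumberTheory.GaloisRepresentations.PadicAlgebraOfLocalField
import HarnessLib

/-!
# Ribet 1977, Thm. (2.1) from Deligne–Serre 1974, Thm. 6.1 (Deligne's theorem as printed)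

A *proofs* file (theorems only, no named fact; D-0026) for the named fact
`Literature.NumberTheory.EllipticCurves.ModularForms.Ribet1977.thm21_exists_galoisRep`
(`NewformGaloisRepDeligneProofs`: for a newform `f ∈ S_k(Γ₁(N))`, `k ≥ 2`, and a prime `ℓ`, a
finite extension `E/ℚ_ℓ` with its module topology, `ι : K_f →+* E` and a continuous
`ρ : Γ_ℚ → GL₂(E)` attached to `f` away from `N ℓ`).  That fact is an XL apex of the tree
(Deligne's construction — étale cohomology of Kuga–Sato varieties, the Eichler–Shimura congruence
relation; `k = 2`: the Tate module of `J₁(N)` — is in neither Mathlib nor `Literature/`), and no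
named fact of the tree implies it.  What this file proves is the **library-side reduction**: the
fact follows, with all glue proved, from the ONE printed statement of Deligne's theorem that the
tree already uses as its Deligne input elsewhere —

* **Deligne–Serre 1974, Thm. 6.1** (*Formes modulaires de poids 1*, p. 521, crediting Deligne
  [5] = Sém. Bourbaki 355): for `g ≠ 0` of type `(k, χ)` on `Γ₀(M)`, `k ≥ 2`, an eigenvector of
  the `T_p` (`p ∤ M`) with eigenvalues `a_p`, `K ⊂ ℂ` a number field containing the `a_p` and the
  `χ(p)`, and **every** finite place `λ` of `K` of residue characteristic `ℓ`, a continuous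
  semisimple `ρ_λ : G → GL₂(K_λ)`, unramified outside `M ℓ`, with
  `det(1 - F_p T) = 1 - a_p T + χ(p) p^{k-1} T²` for `p ∤ M ℓ` ((6.1.1), `F_p` the arithmetic
  Frobenius, footnote (1) p. 513) —

taken as the hypothesis `h61`, **copied verbatim** from
`DeligneSerre1974.thm67_weightOne_of_descent` (`NewformGaloisRepModLProofs`) and
`DeligneSerre1974.thm41_exists_of_thm61` (`DeligneSerreWeightOneOfThm61`), where the weight-one
theory is derived from it.  After this file the tree's whole Deligne debt — `thm21_exists_galoisRep`
(hence its parent `exists_padicGaloisRep_of_isNewform1`, assembled from it in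
`NewformGaloisRepDeligneProofs` / `NewformGaloisRepRibetIrreducibleProofs`) and Deligne–Serre's
Thm. 4.1 / Thm. 6.7 in weight one — funnels through that single printed statement.

## The reduction (`Ribet1977.thm21_exists_galoisRep_of_thm61`)

Given a newform `f ∈ S_k(Γ₁(N))`, `k ≥ 2`, and a prime `ℓ`:

* `K := K_f = coeffCharField f` is a number field: `ℚ(a_n(f) : n)` is finite over `ℚ` by
  Deligne–Serre (2.7.2)–(2.7.3) (`IsNewform1.finiteDimensional_coeffField_of_span_integralLattice1`
  fed with the discharged `DeligneSerre1974_span_integralLattice1_holds`, i.e. the Manin-symbol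
  proof of the rank half of Eichler–Shimura for `Γ₁(N)`), and adjoining the character values
  keeps it finite (`DeligneSerre1974.finiteDimensional_coeffCharField`);
* `f` is of type `(k, ε)`, `ε = nebentypus f` (`IsNewform1.mem_nebentypusSubspace_nebentypus_holds`),
  `f ≠ 0` (`IsNewform1.ne_zero`), and `T_p f = a_p f` for every prime `p`
  (`IsNewform1.heckeEigenvalue_eq_coeff_holds`), so Thm. 6.1 applies with `a_p := a_p(f) ∈ K`,
  `c := ε` (values in `K`, `nebentypusCoeff`) and `e : K ⊆ ℂ`;
* a finite place `v ∣ ℓ` of `K` exists (`exists_place_natCast_mem`: lying over for `ℤ ⊆ 𝓞 K`);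
* `E := K_v` is a finite extension of `ℚ_ℓ` carrying the module topology
  (`finiteDimensional_padic_adicCompletion`, `isModuleTopology_padic_adicCompletion`, for the
  canonical `ℚ_ℓ`-algebra structure `LocalField.adicCompletionPadicAlgebra` of
  `PadicAlgebraOfLocalField`: the `ℚ_ℓ`-span of the dense image of `K` is finite-dimensional,
  hence closed, hence everything; a finite-dimensional Hausdorff space over the complete field
  `ℚ_ℓ` has the module topology, Mathlib `isModuleTopologyOfFiniteDimensional`);
* the `ρ` of Thm. 6.1 at `v` is attached to `f` away from `N ℓ` via
  `ι := (K_f → K_v)`: a prime `p ∤ N ℓ` has `p ∤ N` and `p ∉ v` (else `1 ∈ v`, as `ℓ ∈ v` and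
  `gcd(p, ℓ) = 1`), and the polynomial (6.1.1) is the Hecke polynomial `X² - a_p X + ε(p) p^{k-1}`
  of `f` (`heckePolynomial`).

Semisimplicity and "every `λ`" of Thm. 6.1 are not needed for Thm. (2.1) and are dropped.

## References

* P. Deligne, J.-P. Serre, *Formes modulaires de poids 1*, Ann. Sci. ÉNS (4) 7 (1974), 507–530:
  Thm. 6.1 with (6.1.1) (p. 521), footnote (1) (p. 513), Prop. 2.7 (p. 512).
  [DeligneSerreASENS1974]
* K. A. Ribet, *Galois representations attached to eigenforms with Nebentypus*, LNM 601 (1977),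
  §2, Thm. (2.1) (p. 25). [Ribet1977Nebentypus]
* P. Deligne, *Formes modulaires et représentations ℓ-adiques*, Sém. Bourbaki 355, LNM 179
  (1971), 139–172. [Deligne1971Bourbaki355]
* J.-P. Serre, *Local Fields*, GTM 67, Ch. II §5 (finite extensions of `ℚ_ℓ`).
-/

noncomputable section

open scoped MatrixGroups ModularForm NumberField

open CongruenceSubgroup UpperHalfPlane Polynomial IsDedekindDomain

namespace Literature.NumberTheory.EllipticCurves.ModularForms

/-! ### The completion of a number field at `v ∣ ℓ` is a finite extension of `ℚ_ℓ` -/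

section AdicCompletion

variable {K : Type*} [Field K] [NumberField K] (v : HeightOneSpectrum (𝓞 K)) (ℓ : ℕ)
  [Fact ℓ.Prime]

/-- For `v ∣ ℓ`, scalar multiplication by `ℚ_ℓ` on `K_v` (through the canonical, continuous
embedding `ℚ_ℓ → K_v`, `LocalField.adicCompletionPadicAlgebra`) is continuous. [folklore] -/
theorem continuousSMul_padic_adicCompletion (hv : ((ℓ : ℕ) : 𝓞 K) ∈ v.asIdeal) :
    letI := GaloisRepresentations.LocalField.adicCompletionPadicAlgebra v ℓ hv
    ContinuousSMul ℚ_[ℓ] (v.adicCompletion K) :=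
  letI := GaloisRepresentations.LocalField.adicCompletionPadicAlgebra v ℓ hv
  continuousSMul_of_algebraMap ℚ_[ℓ] (v.adicCompletion K)
    (GaloisRepresentations.LocalField.continuous_algebraMap_adicCompletionPadicAlgebra v ℓ hv)

/-- **`K_v` is a finite extension of `ℚ_ℓ`** (`v ∣ ℓ`, `K` a number field; Serre, *Local Fields*,
Ch. II §5; Neukirch, ANT Ch. II (5.2)): the `ℚ_ℓ`-span of the image of a `ℚ`-basis of `K` is a
finite-dimensional, hence closed (Mathlib `Submodule.closed_of_finiteDimensional`, `ℚ_ℓ` being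
complete), subspace of `K_v` containing the dense image of `K`
(`HeightOneSpectrum.denseRange_algebraMap`), hence all of `K_v`. [folklore] -/
theorem finiteDimensional_padic_adicCompletion (hv : ((ℓ : ℕ) : 𝓞 K) ∈ v.asIdeal) :
    letI := GaloisRepresentations.LocalField.adicCompletionPadicAlgebra v ℓ hv
    FiniteDimensional ℚ_[ℓ] (v.adicCompletion K) := by
  letI := GaloisRepresentations.LocalField.adicCompletionPadicAlgebra v ℓ hv
  haveI : ContinuousSMul ℚ_[ℓ] (v.adicCompletion K) := continuousSMul_padic_adicCompletion v ℓ hv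
  set Kv := v.adicCompletion K
  let b := Module.finBasis ℚ K
  set W : Submodule ℚ_[ℓ] Kv := Submodule.span ℚ_[ℓ] (Set.range fun i ↦ algebraMap K Kv (b i))
  haveI : FiniteDimensional ℚ_[ℓ] W :=
    FiniteDimensional.span_of_finite ℚ_[ℓ] (Set.finite_range _)
  have key : ∀ (q : ℚ) (y : K), algebraMap K Kv (q • y) = (q : ℚ_[ℓ]) • algebraMap K Kv y := by
    intro q y
    rw [Algebra.smul_def, map_mul, eq_ratCast, map_ratCast, Algebra.smul_def, map_ratCast]
  have hKW : Set.range (algebraMap K Kv) ⊆ W := by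
    rintro _ ⟨x, rfl⟩
    rw [← b.sum_repr x, map_sum]
    refine Submodule.sum_mem _ fun i _ ↦ ?_
    rw [key]
    exact Submodule.smul_mem _ _ (Submodule.subset_span ⟨i, rfl⟩)
  have hWclosed : IsClosed (W : Set Kv) := W.closed_of_finiteDimensional
  have hWtop : W = ⊤ := by
    refine Submodule.eq_top_iff'.2 fun x ↦ ?_
    have hx : x ∈ closure (Set.range (algebraMap K Kv)) :=
      (HeightOneSpectrum.denseRange_algebraMap (K := K) v) x
    exact hWclosed.closure_subset_iff.2 hKW hx
  rw [hWtop] at this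
  exact Module.Finite.of_surjective (Submodule.topEquiv.toLinearMap)
    (Submodule.topEquiv (R := ℚ_[ℓ]) (M := Kv)).surjective

/-- **`K_v` (`v ∣ ℓ`) carries the `ℚ_ℓ`-module topology**: a finite-dimensional Hausdorff
topological vector space over the complete field `ℚ_ℓ` has the module topology (Mathlib
`isModuleTopologyOfFiniteDimensional`). [folklore] -/
theorem isModuleTopology_padic_adicCompletion (hv : ((ℓ : ℕ) : 𝓞 K) ∈ v.asIdeal) :
    letI := GaloisRepresentations.LocalField.adicCompletionPadicAlgebra v ℓ hv
    IsModuleTopology ℚ_[ℓ] (v.adicCompletion K) := by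
  letI := GaloisRepresentations.LocalField.adicCompletionPadicAlgebra v ℓ hv
  haveI : ContinuousSMul ℚ_[ℓ] (v.adicCompletion K) := continuousSMul_padic_adicCompletion v ℓ hv
  haveI : FiniteDimensional ℚ_[ℓ] (v.adicCompletion K) :=
    finiteDimensional_padic_adicCompletion v ℓ hv
  exact isModuleTopologyOfFiniteDimensional

omit [Fact ℓ.Prime] in
/-- A number field has a finite place above every rational prime `ℓ` (lying over for the
integral extension `ℤ ⊆ 𝓞 K`). [folklore] -/
theorem exists_place_natCast_mem (hℓ : ℓ.Prime) :
    ∃ v : HeightOneSpectrum (𝓞 K), ((ℓ : ℕ) : 𝓞 K) ∈ v.asIdeal := by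
  haveI hP : (Ideal.span {(ℓ : ℤ)}).IsMaximal :=
    Ideal.IsPrime.isMaximal ((Ideal.span_singleton_prime (by exact_mod_cast hℓ.ne_zero)).2
      (Nat.prime_iff_prime_int.1 hℓ)) (by simpa using hℓ.ne_zero)
  obtain ⟨Q, hQ, hQover⟩ :=
    Ideal.exists_maximal_ideal_liesOver_of_isIntegral (S := 𝓞 K) (Ideal.span {(ℓ : ℤ)})
  have hunder : Q.under ℤ = Ideal.span {(ℓ : ℤ)} := hQover.over.symm
  have hQbot : Q ≠ ⊥ := by
    intro hQ0
    have : Ideal.span {(ℓ : ℤ)} = ⊥ := by rw [← hunder, hQ0, Ideal.under_bot]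
    exact (by exact_mod_cast hℓ.ne_zero : (ℓ : ℤ) ≠ 0) (Ideal.span_singleton_eq_bot.1 this)
  refine ⟨⟨Q, hQ.isPrime, hQbot⟩, ?_⟩
  have hℓ' : (ℓ : ℤ) ∈ Q.under ℤ := by rw [hunder]; exact Ideal.mem_span_singleton_self _
  rw [Ideal.mem_under, map_natCast] at hℓ'
  exact hℓ'

omit [NumberField K] [Fact ℓ.Prime] in
/-- Two distinct rational primes do not lie in the same prime of `𝓞 K` (`gcd = 1` would put `1`
in it). [folklore] -/
theorem natCast_not_mem_of_prime_ne {p : ℕ} (hp : p.Prime) (hℓ : ℓ.Prime) (hpℓ : p ≠ ℓ)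
    (hv : ((ℓ : ℕ) : 𝓞 K) ∈ v.asIdeal) : ((p : ℕ) : 𝓞 K) ∉ v.asIdeal := by
  intro hpv
  have hcop : Nat.Coprime p ℓ := (Nat.coprime_primes hp hℓ).mpr hpℓ
  have h1 : (1 : 𝓞 K) ∈ v.asIdeal := by
    have h := Nat.gcd_eq_gcd_ab p ℓ
    rw [hcop.gcd_eq_one, Nat.cast_one] at h
    have h' : (1 : 𝓞 K) = (p : 𝓞 K) * (Nat.gcdA p ℓ : 𝓞 K) + (ℓ : 𝓞 K) * (Nat.gcdB p ℓ : 𝓞 K) := by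
      have := congrArg (fun z : ℤ ↦ (z : 𝓞 K)) h
      push_cast at this
      exact this
    rw [h']
    exact Ideal.add_mem _ (Ideal.mul_mem_right _ _ hpv) (Ideal.mul_mem_right _ _ hv)
  exact v.isPrime.ne_top ((Ideal.eq_top_iff_one _).2 h1)

end AdicCompletion

/-! ### Thm. (2.1) from Deligne–Serre's Thm. 6.1 -/

section Reduction

open Rat.HeightOneSpectrum

variable {N : ℕ} [NeZero N] {k : ℤ}

/-- **Ribet 1977, Thm. (2.1) (= the named fact `Ribet1977.thm21_exists_galoisRep`) from
Deligne–Serre 1974, Thm. 6.1 as printed.**  Grant Thm. 6.1 (op. cit. p. 521, Deligne's theorem: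
for `g ≠ 0` of type `(k, χ)` on `Γ₁(M)`, `k ≥ 2`, a `T_p`-eigenvector (`p ∤ M`) with eigenvalues
`a_p` in a number field `K ∋ χ(d)`, embedded in `ℂ` by `e`, and every finite place `v` of `K`, a
continuous semisimple `ρ : Gal(ℚ̄/ℚ) → GL₂(K_v)`, unramified at `p ∤ M` with `p ∉ v`, where the
arithmetic Frobenius has characteristic polynomial `X² - a_p X + χ(p) p^{k-1}` (6.1.1)) — the
hypothesis `h61`, verbatim that of `DeligneSerre1974.thm41_exists_of_thm61`.  Then for every
newform `f ∈ S_k(Γ₁(N))`, `k ≥ 2`, and prime `ℓ` there are a finite extension `E/ℚ_ℓ` with its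
module topology, `ι : K_f →+* E` and a continuous `ρ : Γ_ℚ → GL₂(E)` attached to `f` away from
`N ℓ` (`IsGaloisRepOfNewform1`): take `K = K_f` (a number field by Deligne–Serre (2.7.2)–(2.7.3),
proved in the tree), `a_p = a_p(f)`, `c = ε = nebentypus f` (`T_p f = a_p f`, `f ∈ S_k(N, ε)`,
`f ≠ 0`, all proved), a place `v ∣ ℓ` of `K`, `E = K_v` with its canonical `ℚ_ℓ`-algebra structure
(finite-dimensional with the module topology, `finiteDimensional_padic_adicCompletion`,
`isModuleTopology_padic_adicCompletion`), `ι = (K_f → K_v)` and the `ρ` of Thm. 6.1 at `v`; a prime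
`p ∤ N ℓ` has `p ∤ N` and `p ∉ v`, and (6.1.1) is the Hecke polynomial of `f` at `p`.
[cite: DeligneSerreASENS1974, Thm. 6.1 with (6.1.1) (p. 521)]
[cite: Ribet1977Nebentypus, Thm. (2.1) (LNM 601 p. 25)] -/
theorem Ribet1977.thm21_exists_galoisRep_of_thm61
    (h61 : ∀ (M : ℕ) [NeZero M] (k : ℤ), 2 ≤ k →
      ∀ (g : CuspForm (Gamma1 M) k) (χ : DirichletCharacter ℂ M),
        g ∈ nebentypusSubspace M k χ → g ≠ 0 →
      ∀ (K : Type) [Field K] [NumberField K] (e : K →+* ℂ) (a : ℕ → K) (c : ZMod M → K),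
        (∀ d, e (c d) = χ d) →
        (∀ (p : ℕ) (hp : p.Prime), ¬ p ∣ M →
          (haveI : NeZero p := ⟨hp.ne_zero⟩; heckeT (Gamma1 M) k p g) = e (a p) • g) →
      ∀ v : HeightOneSpectrum (𝓞 K),
        ∃ ρ : GaloisRepresentations.FramedGaloisRep ℚ (v.adicCompletion K) 2,
          ρ.toGaloisRep.IsSemisimple ∧
          ∀ w : HeightOneSpectrum (𝓞 ℚ), ¬ ((primesEquiv w : Nat.Primes) : ℕ) ∣ M →
            (((primesEquiv w : Nat.Primes) : ℕ) : 𝓞 K) ∉ v.asIdeal →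
            ρ.IsUnramifiedAt w ∧
            ρ.HasFrobCharpolyAt w
              ((X ^ 2 - C (a ((primesEquiv w : Nat.Primes) : ℕ)) * X +
                C (c ((primesEquiv w : Nat.Primes) : ℕ) *
                  (((primesEquiv w : Nat.Primes) : ℕ) : K) ^ (k - 1))).map
                (algebraMap K (v.adicCompletion K)))) :
    Ribet1977.thm21_exists_galoisRep (N := N) (k := k) := by
  intro f hk hf ℓ _
  classical
  have hℓ : ℓ.Prime := Fact.out
  -- `K_f` is a number field (Deligne–Serre (2.7.2)–(2.7.3), proved in the tree)
  haveI : FiniteDimensional ℚ (coeffField f) :=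
    (IsNewform1.finiteDimensional_coeffField_of_span_integralLattice1
      (DeligneSerre1974_span_integralLattice1_holds N k)) hf
  haveI : FiniteDimensional ℚ (coeffCharField f) :=
    DeligneSerre1974.finiteDimensional_coeffCharField f
  haveI : NumberField (coeffCharField f) := NumberField.mk
  -- the data of Thm. 6.1 for `f`
  let e : coeffCharField f →+* ℂ := algebraMap (coeffCharField f) ℂ
  let a : ℕ → coeffCharField f := fun n ↦
    ⟨(qExpansion 1 ⇑f).coeff n, cuspCoeff_mem_coeffCharField f n⟩
  let c : ZMod N → coeffCharField f := fun d ↦ nebentypusCoeff f d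
  have hc : ∀ d, e (c d) = nebentypus f d := fun d ↦ rfl
  have hfW : f ∈ nebentypusSubspace N k (nebentypus f) :=
    IsNewform1.mem_nebentypusSubspace_nebentypus_holds hf
  have hf0 : f ≠ 0 := hf.ne_zero
  have hT : ∀ (p : ℕ) (hp : p.Prime), ¬ p ∣ N →
      (haveI : NeZero p := ⟨hp.ne_zero⟩; heckeT (Gamma1 N) k p f) = e (a p) • f := by
    intro p hp _
    haveI : NeZero p := ⟨hp.ne_zero⟩
    rw [heckeT_eq_heckeEigenvalue_smul f p (hf.2.1 p hp),
      IsNewform1.heckeEigenvalue_eq_coeff_holds hf hp]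
    rfl
  -- a place `v ∣ ℓ` of `K_f` and Deligne's representation over `K_v`
  obtain ⟨v, hℓv⟩ := exists_place_natCast_mem (K := coeffCharField f) ℓ hℓ
  obtain ⟨ρ, -, hρ⟩ := h61 N k hk f (nebentypus f) hfW hf0 (coeffCharField f) e a c hc hT v
  -- `E = K_v`, a finite extension of `ℚ_ℓ` with its module topology
  letI := GaloisRepresentations.LocalField.adicCompletionPadicAlgebra v ℓ hℓv
  haveI := finiteDimensional_padic_adicCompletion v ℓ hℓv
  haveI := isModuleTopology_padic_adicCompletion v ℓ hℓv
  refine ⟨v.adicCompletion (coeffCharField f), inferInstance, inferInstance, inferInstance,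
    inferInstance, inferInstance, algebraMap (coeffCharField f) (v.adicCompletion (coeffCharField f)),
    ρ, ?_⟩
  -- `ρ` is attached to `f` away from `N ℓ`
  intro w hw
  have hp : ((primesEquiv w : Nat.Primes) : ℕ).Prime := (primesEquiv w).2
  have hpN : ¬ ((primesEquiv w : Nat.Primes) : ℕ) ∣ N := fun h ↦ hw (h.mul_right ℓ)
  have hpℓ : ((primesEquiv w : Nat.Primes) : ℕ) ≠ ℓ := fun h ↦ hw (h ▸ dvd_mul_left _ N)
  obtain ⟨hur, hchar⟩ := hρ w hpN (natCast_not_mem_of_prime_ne v ℓ hp hℓ hpℓ hℓv)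
  refine ⟨hur, ?_⟩
  have hconst : (⟨(nebentypus f (((primesEquiv w : Nat.Primes) : ℕ) : ZMod N) : ℂ) *
        (((primesEquiv w : Nat.Primes) : ℕ) : ℂ) ^ (k - 1),
        nebentypus_mul_zpow_mem_coeffCharField f _⟩ : coeffCharField f) =
      c ((primesEquiv w : Nat.Primes) : ℕ) *
        (((primesEquiv w : Nat.Primes) : ℕ) : coeffCharField f) ^ (k - 1) := by
    apply (algebraMap (coeffCharField f) ℂ).injective
    rw [map_mul, map_zpow₀, map_natCast (algebraMap (coeffCharField f) ℂ)]
    rfl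
  have hpoly : heckePolynomial f ((primesEquiv w : Nat.Primes) : ℕ) =
      X ^ 2 - C (a ((primesEquiv w : Nat.Primes) : ℕ)) * X +
        C (c ((primesEquiv w : Nat.Primes) : ℕ) *
          (((primesEquiv w : Nat.Primes) : ℕ) : coeffCharField f) ^ (k - 1)) := by
    rw [heckePolynomial, hconst]
  rw [hpoly]
  exact hchar

end Reduction

end Literature.NumberTheory.EllipticCurves.ModularForms
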